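import Summits.BirchSwinnertonDyer.BirchSwinnertonDyer.Theorems.SmallImageMuTransferMuTransferX9SelmerDualLayer
import Summits.BirchSwinnertonDyer.BirchSwinnertonDyer.Theorems.SmallImageMuTransferMuTransferX9StepZero
import Summits.BirchSwinnertonDyer.BirchSwinnertonDyer.Theorems.SmallImageMuTransferMuTransferX9TorsionUnramifiedOutside
import Literature.NumberTheory.EllipticCurves.IwasawaTwistModPTowerEmbed
import Literature.NumberTheory.EllipticCurves.KatoFineSelmerFiniteProofs
import Literature.NumberTheory.EllipticCurves.SelmerInftyTorsionFiniteProofs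
import Literature.NumberTheory.GaloisCohomology.PoitouTate
import Literature.NumberTheory.GaloisRepresentations.LocalEulerPoincareCharacteristic
import Literature.NumberTheory.GaloisRepresentations.BlochKatoSelmerGroup
import HarnessLib

/-!
# K6 crux `MuTransferX9` (stmt-BirchSwinnertonDyer-19276), stub `stub_selmerDualOdd` (skeleton v6):
# the ASSEMBLY — the registered stub from its algebraic half (kernel: layer descent, dual-twist Shapiro,
# `T`-embeddings) and THREE LOCAL LEMMAS stated verbatim as hypotheses

Cell `bsd-smallim`, seat `bsd-smallim-k6-c2` (gen 3). HONEST FRAMING: theorems only (no definition, no named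
fact, no `sorry`); nothing is asserted about any curve and nothing is booked. This file PINS the remaining
content of the registered stub `stub_selmerDualOdd` (skeleton v6, sha16 a90a661b046bb403) of crux 19276:
`stub_selmerDualOdd_of_local` proves the stub's statement VERBATIM from

* the KERNEL algebraic half — `SelmerDual.exists_invTwist_class_of_iterate_ne_zero` (p453423:
  `y ∈ H¹(ℚ_∞, E[p])` with `(conj_γ − id)^J y ≠ 0` ⟹ `Y = Sh⁻¹(y_n) ∈ H¹(ℚ, 𝒯_{p^n}(E, κ⁻¹))` with
  `T^J Y ≠ 0`), `ZpExtension.exists_level_class_of_shiftH1_iterate_ne_zero` (p454735: an avatar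
  `Ψ ∈ H¹(ℚ, 𝒯_{J+1}(E, κ⁻¹))`, `T^J Ψ ≠ 0`, `T^{p^n−J−1}·Ψ = T^k Y`), `E[p]^{Γ_ℚ} = 0` from irreducibility
  (`LevelE.torsionGaloisModule_fixed_eq_zero_of_irr`), and the finite exceptional set `S₁ ⊇ S₀` off which
  `v ∤ p`, `E` has good reduction and `E[p]` is unramified
  (`TorsionUnramified.exists_finite_superset_isUnramifiedAt_torsionGaloisModule`);
* and three LOCAL statements, hypotheses `hLbad`, `hLp`, `hLur` (each with the stub's own binder prefix, so
  that each is a self-contained target for a hand):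
  (L-bad) at every `v ∤ p` a UNIFORM exponent `ε_v` with `loc_v (T^{ε_v} c) = 0` for ALL classes `c` of
  ALL levels of the dual twist (k6-g4's `localization_shiftH1_iterate_eq_zero`, #H¹(ℚ_v, 𝒯_J) bounded by the
  local Euler characteristic + (2,0)-duality; `v` does not split completely in the cyclotomic tower);
  (L-p) at the place over `p`: an exponent `ε_p` with `loc_v (T^{ε'} Ψ) = 0` for `ε' ≥ ε_p` and every `Ψ`
  ARISING FROM A FINE CLASS `y` by the construction above (data `y_n, Y, Ψ, k` with their three defining
  relations) — the fine condition at the unique place of `ℚ_∞` over `p` + local Shapiro at the totally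
  ramified prime (MU-TRANSFER-PROOF (F6)/STEP 1 "`T^ε · loc_v y = 0`");
  (L-ur) at `v ∤ p` where `E[p]` is unramified: `loc_v Ψ` is unramified for every such `Ψ` (fine condition
  ⟹ `y` unramified above `v` ⟹ `y_n` ⟹ `Y = cor(ι_* y_n)` ⟹ `Ψ`).
  The uniform `ε` of the stub is `ε_p + max_{v ∈ S₁, v ∤ p} ε_v`.

PARTITION (D-0054): X9 (A4) × p ∈ {5,7} (+ X10b∧¬Surj at 3 via v6) — helper toward `stub_selmerDualOdd`; closes
none (the stub closes when (L-bad), (L-p), (L-ur) land).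

References: HOME/koly/MU-TRANSFER-PROOF.md (F6), §5 STEP 1; R. Greenberg, LNM 1716 (1999) §3 [GreenbergLNM1716];
B. Mazur, K. Rubin, Mem. AMS 799 (2004) §5.3 [MazurRubin2004]; J. S. Milne, *ADT* I 2.8, 4.10 [MilneADT2006].
-/

set_option linter.dupNamespace false
set_option autoImplicit false

noncomputable section

open scoped Classical NumberField
open Field IsDedekindDomain
open WeierstrassCurve (geomTorsion)
open Literature.NumberTheory.GaloisRepresentations
open Literature.NumberTheory.GaloisCohomology
open Literature.NumberTheory.EllipticCurves

namespace Summit.BirchSwinnertonDyer.BirchSwinnertonDyer.Rank1Residual.SelmerDual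

/-- **`stub_selmerDualOdd` (skeleton v6 of crux 19276, verbatim) from its three local lemmas.**
Hypotheses `hLbad` (uniform local exponent at `v ∤ p`), `hLp` (the place over `p`, for the classes `Ψ`
constructed from a fine `y`), `hLur` (unramified at good `v ∤ p` for the same `Ψ`) — see the module
docstring; everything else (layer descent, dual-twist Shapiro with `T = conj_γ − 1`, the avatar of exact
level, `E[p]^{Γ_ℚ} = 0`, the finite exceptional set) is kernel.
[cite: GreenbergLNM1716, §3 Lemma 3.2] [cite: MazurRubin2004, §5.3] [cite: MilneADT2006, Ch. I, Thm. 4.10] -/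
theorem stub_selmerDualOdd_of_local
    (hLbad : ∀ (W : WeierstrassCurve ℚ) [W.IsElliptic] [W.IsGloballyMinimal] (p : ℕ) [Fact p.Prime]
      (κ : ZpExtension ℚ p) (γ : absoluteGaloisGroup ℚ),
      p ≠ 2 → W.HasIrreducibleModPGaloisRep p → ¬ W.HasSurjectiveModNGaloisRep p →
      κ.IsCyclotomic → κ.IsTopGenerator γ →
      (∀ v : HeightOneSpectrum (𝓞 ℚ), localEulerPoincareCharacteristic (v.adicCompletion ℚ)) →
      poitouTate_sum_localTatePairing_eq_zero ℚ →
      ∀ v : HeightOneSpectrum (𝓞 ℚ), ((p : ℕ) : 𝓞 ℚ) ∉ v.asIdeal →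
        ∃ εv : ℕ, ∀ (J : ℕ) (c : galoisCohomology (W.modPTwist p κ.invTwist J) 1),
          galoisCohomology.localization (W.modPTwist p κ.invTwist J) (Sum.inr v) 1
            ((κ.invTwist.shiftH1 (W.torsionGaloisModule (p : ℤ))
              (fun P : WeierstrassCurve.geomTorsion W (p : ℤ) => AddSubgroup.torsionBy.nsmul P) J)^[εv] c) = 0)
    (hLp : ∀ (W : WeierstrassCurve ℚ) [W.IsElliptic] [W.IsGloballyMinimal] (p : ℕ) [Fact p.Prime]
      (κ : ZpExtension ℚ p) (γ : absoluteGaloisGroup ℚ),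
      p ≠ 2 → W.HasIrreducibleModPGaloisRep p → ¬ W.HasSurjectiveModNGaloisRep p →
      κ.IsCyclotomic → κ.IsTopGenerator γ →
      (∀ v : HeightOneSpectrum (𝓞 ℚ), localEulerPoincareCharacteristic (v.adicCompletion ℚ)) →
      poitouTate_sum_localTatePairing_eq_zero ℚ →
      ∃ εp : ℕ, ∀ (v : HeightOneSpectrum (𝓞 ℚ)), ((p : ℕ) : 𝓞 ℚ) ∈ v.asIdeal →
        ∀ (J n : ℕ) (hJn : J + 1 ≤ p ^ n)
          (y : Literature.NumberTheory.EllipticCurves.subgroupH1 κ.kerSubgroup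
            (WeierstrassCurve.geomTorsion W (p : ℤ))),
          W.torsionToPrimaryH1Sub p κ.kerSubgroup y ∈ W.fineSelmerInfty κ →
          ∀ (yn : Literature.NumberTheory.EllipticCurves.subgroupH1 (κ.invTwist.layerSubgroup n)
              (WeierstrassCurve.geomTorsion W (p : ℤ)))
            (Y : galoisCohomology (W.modPTwist p κ.invTwist (p ^ n)) 1)
            (Ψ : galoisCohomology (W.modPTwist p κ.invTwist (J + 1)) 1) (k : ℕ),
            Literature.NumberTheory.EllipticCurves.resOfLe (WeierstrassCurve.geomTorsion W (p : ℤ))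
                (κ.invTwist.kerSubgroup_le_layerSubgroup n) yn =
              Literature.NumberTheory.EllipticCurves.resOfLe (WeierstrassCurve.geomTorsion W (p : ℤ))
                (κ.kerSubgroup_unitTwist (-1)).le y →
            κ.invTwist.twistModPH1Equiv (W.torsionGaloisModule (p : ℤ))
              (fun P : WeierstrassCurve.geomTorsion W (p : ℤ) => AddSubgroup.torsionBy.nsmul P) n Y = yn →
            galoisCohomology.map (κ.invTwist.twistModPShiftEmbed (W.torsionGaloisModule (p : ℤ))
              (fun P : WeierstrassCurve.geomTorsion W (p : ℤ) => AddSubgroup.torsionBy.nsmul P) (p ^ n) hJn)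
                1 Ψ =
              (κ.invTwist.shiftH1 (W.torsionGaloisModule (p : ℤ))
                (fun P : WeierstrassCurve.geomTorsion W (p : ℤ) => AddSubgroup.torsionBy.nsmul P)
                (p ^ n))^[k] Y →
            ∀ ε' : ℕ, εp ≤ ε' →
              galoisCohomology.localization (W.modPTwist p κ.invTwist (J + 1)) (Sum.inr v) 1
                ((κ.invTwist.shiftH1 (W.torsionGaloisModule (p : ℤ))
                  (fun P : WeierstrassCurve.geomTorsion W (p : ℤ) => AddSubgroup.torsionBy.nsmul P)
                  (J + 1))^[ε'] Ψ) = 0)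
    (hLur : ∀ (W : WeierstrassCurve ℚ) [W.IsElliptic] [W.IsGloballyMinimal] (p : ℕ) [Fact p.Prime]
      (κ : ZpExtension ℚ p) (γ : absoluteGaloisGroup ℚ),
      p ≠ 2 → W.HasIrreducibleModPGaloisRep p → ¬ W.HasSurjectiveModNGaloisRep p →
      κ.IsCyclotomic → κ.IsTopGenerator γ →
      ∀ (v : HeightOneSpectrum (𝓞 ℚ)), ((p : ℕ) : 𝓞 ℚ) ∉ v.asIdeal →
        GaloisRep.IsUnramifiedAt v (W.torsionGaloisModule (p : ℤ)) →
        ∀ (J n : ℕ) (hJn : J + 1 ≤ p ^ n)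
          (y : Literature.NumberTheory.EllipticCurves.subgroupH1 κ.kerSubgroup
            (WeierstrassCurve.geomTorsion W (p : ℤ))),
          W.torsionToPrimaryH1Sub p κ.kerSubgroup y ∈ W.fineSelmerInfty κ →
          ∀ (yn : Literature.NumberTheory.EllipticCurves.subgroupH1 (κ.invTwist.layerSubgroup n)
              (WeierstrassCurve.geomTorsion W (p : ℤ)))
            (Y : galoisCohomology (W.modPTwist p κ.invTwist (p ^ n)) 1)
            (Ψ : galoisCohomology (W.modPTwist p κ.invTwist (J + 1)) 1) (k : ℕ),
            Literature.NumberTheory.EllipticCurves.resOfLe (WeierstrassCurve.geomTorsion W (p : ℤ))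
                (κ.invTwist.kerSubgroup_le_layerSubgroup n) yn =
              Literature.NumberTheory.EllipticCurves.resOfLe (WeierstrassCurve.geomTorsion W (p : ℤ))
                (κ.kerSubgroup_unitTwist (-1)).le y →
            κ.invTwist.twistModPH1Equiv (W.torsionGaloisModule (p : ℤ))
              (fun P : WeierstrassCurve.geomTorsion W (p : ℤ) => AddSubgroup.torsionBy.nsmul P) n Y = yn →
            galoisCohomology.map (κ.invTwist.twistModPShiftEmbed (W.torsionGaloisModule (p : ℤ))
              (fun P : WeierstrassCurve.geomTorsion W (p : ℤ) => AddSubgroup.torsionBy.nsmul P) (p ^ n) hJn)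
                1 Ψ =
              (κ.invTwist.shiftH1 (W.torsionGaloisModule (p : ℤ))
                (fun P : WeierstrassCurve.geomTorsion W (p : ℤ) => AddSubgroup.torsionBy.nsmul P)
                (p ^ n))^[k] Y →
            galoisCohomology.localization (W.modPTwist p κ.invTwist (J + 1)) (Sum.inr v) 1 Ψ ∈
              DiscreteGaloisModule.unramifiedSubgroup
                (GaloisRep.toLocal v (W.modPTwist p κ.invTwist (J + 1))) 1) :
    ∀ (W : WeierstrassCurve ℚ) [W.IsElliptic] [W.IsGloballyMinimal] (p : ℕ) [Fact p.Prime]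
      (κ : ZpExtension ℚ p) (γ : absoluteGaloisGroup ℚ),
      p ≠ 2 → W.HasIrreducibleModPGaloisRep p → ¬ W.HasSurjectiveModNGaloisRep p →
      κ.IsCyclotomic → κ.IsTopGenerator γ →
      (∀ v : HeightOneSpectrum (𝓞 ℚ), localEulerPoincareCharacteristic (v.adicCompletion ℚ)) →
      poitouTate_sum_localTatePairing_eq_zero ℚ →
      ∀ (S₀ : Set (HeightOneSpectrum (𝓞 ℚ))), S₀.Finite →
      ∃ (ε : ℕ) (S : Set (HeightOneSpectrum (𝓞 ℚ))), S.Finite ∧ S₀ ⊆ S ∧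
        ∀ (J : ℕ) (y : Literature.NumberTheory.EllipticCurves.subgroupH1 κ.kerSubgroup
            (WeierstrassCurve.geomTorsion W (p : ℤ))),
          W.torsionToPrimaryH1Sub p κ.kerSubgroup y ∈ W.fineSelmerInfty κ →
          (⇑(Literature.NumberTheory.EllipticCurves.conjH1 κ.kerSubgroup
              (WeierstrassCurve.geomTorsion W (p : ℤ)) γ -
            AddMonoidHom.id (Literature.NumberTheory.EllipticCurves.subgroupH1 κ.kerSubgroup
              (WeierstrassCurve.geomTorsion W (p : ℤ)))))^[J] y ≠ 0 →
          ∃ Ψ : galoisCohomology (W.modPTwist p κ.invTwist (J + 1)) 1,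
            (κ.invTwist.shiftH1 (W.torsionGaloisModule (p : ℤ))
                (fun P : WeierstrassCurve.geomTorsion W (p : ℤ) => AddSubgroup.torsionBy.nsmul P)
                (J + 1))^[J] Ψ ≠ 0 ∧
            (∀ v : HeightOneSpectrum (𝓞 ℚ), v ∉ S →
              galoisCohomology.localization (W.modPTwist p κ.invTwist (J + 1)) (Sum.inr v) 1 Ψ ∈
                DiscreteGaloisModule.unramifiedSubgroup
                  (GaloisRep.toLocal v (W.modPTwist p κ.invTwist (J + 1))) 1) ∧
            (∀ v : HeightOneSpectrum (𝓞 ℚ), v ∈ S →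
              galoisCohomology.localization (W.modPTwist p κ.invTwist (J + 1)) (Sum.inr v) 1
                ((κ.invTwist.shiftH1 (W.torsionGaloisModule (p : ℤ))
                  (fun P : WeierstrassCurve.geomTorsion W (p : ℤ) => AddSubgroup.torsionBy.nsmul P)
                  (J + 1))^[ε] Ψ) = 0) := by
  intro W _ _ p _ κ γ hp2 hirr hns hκ hγ hEP hPT S₀ hS₀
  have hp : p.Prime := Fact.out
  -- the local inputs for this `(W, p, κ, γ)`
  have hbad := hLbad W p κ γ hp2 hirr hns hκ hγ hEP hPT
  obtain ⟨εp, hpl⟩ := hLp W p κ γ hp2 hirr hns hκ hγ hEP hPT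
  have hur := hLur W p κ γ hp2 hirr hns hκ hγ
  -- the exceptional set `S ⊇ S₀`: off `S`, `v ∤ p`, good reduction, `E[p]` unramified
  obtain ⟨S, hS, hS₀S, hSoff⟩ :=
    TorsionUnramified.exists_finite_superset_isUnramifiedAt_torsionGaloisModule W hp.ne_zero hS₀
  -- the uniform exponent: `ε = εp + max_{v ∈ S, v ∤ p} ε_v`
  let f : HeightOneSpectrum (𝓞 ℚ) → ℕ := fun v =>
    if h : ((p : ℕ) : 𝓞 ℚ) ∉ v.asIdeal then Classical.choose (hbad v h) else 0
  have hf : ∀ (v : HeightOneSpectrum (𝓞 ℚ)) (h : ((p : ℕ) : 𝓞 ℚ) ∉ v.asIdeal)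
      (J : ℕ) (c : galoisCohomology (W.modPTwist p κ.invTwist J) 1),
      galoisCohomology.localization (W.modPTwist p κ.invTwist J) (Sum.inr v) 1
        ((κ.invTwist.shiftH1 (W.torsionGaloisModule (p : ℤ))
          (fun P : WeierstrassCurve.geomTorsion W (p : ℤ) => AddSubgroup.torsionBy.nsmul P) J)^[f v] c) = 0 := by
    intro v h J c
    have hfv : f v = Classical.choose (hbad v h) := dif_pos h
    rw [hfv]
    exact Classical.choose_spec (hbad v h) J c
  set ε : ℕ := εp + hS.toFinset.sup f with hεdef
  refine ⟨ε, S, hS, hS₀S, fun J y hy hyT => ?_⟩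
  -- the algebraic half: `Y = Sh⁻¹(y_n)` at a layer `n` with `J + 1 ≤ p^n`, then the avatar `Ψ`
  obtain ⟨n₀, hn₀⟩ := exists_invTwist_class_of_iterate_ne_zero W p κ hγ J y hyT
  set n : ℕ := max n₀ (J + 1) with hndef
  have hJn : J + 1 ≤ p ^ n :=
    le_trans (le_max_right n₀ (J + 1)) (Nat.lt_pow_self hp.one_lt).le
  obtain ⟨yn, Y, hyn, hSh, hYT⟩ := hn₀ n (le_max_left n₀ (J + 1))
  have hinv := LevelE.torsionGaloisModule_fixed_eq_zero_of_irr W p hirr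
  obtain ⟨k, Ψ, hΨT, hΨemb⟩ := κ.invTwist.exists_level_class_of_shiftH1_iterate_ne_zero
    (W.torsionGaloisModule (p : ℤ)) (fun P => AddSubgroup.torsionBy.nsmul P) hinv hJn Y hYT
  refine ⟨Ψ, hΨT, fun v hv => ?_, fun v hv => ?_⟩
  · -- unramified off `S`
    obtain ⟨hvp, -, hvur⟩ := hSoff v hv
    exact hur v hvp hvur J n hJn y hy yn Y Ψ k hyn hSh hΨemb
  · -- `T^ε`-killed on `S`
    by_cases hvp : ((p : ℕ) : 𝓞 ℚ) ∈ v.asIdeal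
    · exact hpl v hvp J n hJn y hy yn Y Ψ k hyn hSh hΨemb ε (Nat.le_add_right εp _)
    · have hfle : f v ≤ hS.toFinset.sup f := Finset.le_sup (hS.mem_toFinset.mpr hv)
      have hε : ε = f v + (ε - f v) := by omega
      rw [hε, Function.iterate_add_apply]
      exact hf v hvp (J + 1) _

end Summit.BirchSwinnertonDyer.BirchSwinnertonDyer.Rank1Residual.SelmerDual

end
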